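import Literature.AlgebraicGeometry.Resolution.ArithmeticalThreefoldsLocalGeneralStep
import Literature.AlgebraicGeometry.Resolution.ArithmeticalThreefoldsLocalInseparable
import Literature.AlgebraicGeometry.Resolution.TameTowerPGroupTowers
import Literature.FieldTheory.ArtinSchreier.PrimeDegree
import Mathlib.FieldTheory.KummerExtension
import Mathlib.FieldTheory.PurelyInseparable.Basic
import Mathlib.RingTheory.Polynomial.Cyclotomic.Roots
import HarnessLib

/-!
# Cossart–Piltant's climb along towers of normal extensions of degree `p`

Topic: `Literature/AlgebraicGeometry/Resolution`. PROOF side of `CossartPiltant2019ReductionP`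
(`ArithmeticalThreefoldsLocal.lean`), continued from
`ArithmeticalThreefoldsLocalGeneralStep.lean` (one degree-`p` step from step data on the model)
and `ArithmeticalThreefoldsLocalInseparable.lean` (the purely inseparable tower). In the proof
of journal Prop. 4.10 (arXiv v1 Prop. 4.8, p. 54) the second use of the local theorem
(Thm. 1.5 (ii)) is along the Galois `p`-tower `Kʳ ⊇ Fʳ`:

> `Kʳ|Fʳ` is a tower of Galois extensions of degree `p` … we may assume `Kʳ|Fʳ` is a single
> Galois extension of degree `p`. Let `x ∈ O_{vʳ}` be a primitive element with minimal
> polynomial `h = X^p + f₁X^{p-1} + ⋯ + f_p ∈ O_{v₀ʳ}[X]` … we may take `fᵢ ∈ Tʳ` … Theorem 1.5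
> (ii) states that `(LU vʳ)` holds.

This file mechanises that use, with the standard choice of the primitive element making
`S[t]_P[x]` stable under the Galois group (hypothesis (G) of Thm. 1.5 (ii)): an Artin–Schreier
generator in characteristic `p` (`ϑ^p − ϑ = a`, `σϑ = ϑ + i`; Lang, *Algebra* VI Thm. 6.4) and a
Kummer generator when the base contains a primitive `p`-th root of unity (`ϑ^p = a`, `σϑ = ζ^iϑ`;
Mathlib's `exists_root_adjoin_eq_top_of_isCyclic`), rescaled into the model; in the Kummer case
the root of unity `ζ^i ∈ Frac S[t]` is written with a `v`-unit denominator because the regular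
local ring `S[t]_P` is normal (Matsumura Thm. 19.4).

* `exists_mul_eq_of_isIntegral_of_isRegularLocalRing` — normality of `S[t]_P` at the level of
  the ambient field: an element of `Frac S[t]` integral over `S[t]` is `c/d` with `c, d ∈ S[t]`,
  `v(d) = 1`.
* `CossartPiltant2019Local.exists_model_of_isGalois_of_finrank_eq` — **the Galois degree-`p`
  step**: climbing data at a subfield `M ∋ S` of `Ω` and `M₁ | M` Galois of degree `p`, with
  `char Ω = p` or `ζ_p ∈ M`, give climbing data at `M₁`.
* `CossartPiltant2019Local.exists_model_of_isNormalPTower` — **climbing a finite tower of normal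
  extensions of degree `p`** (`IsNormalPTower`, `HenselizedFunctionFields.lean`): each step is
  either Galois (previous item) or, being of prime degree and inseparable, purely inseparable
  (`CossartPiltant2019Local.exists_model_of_forall_pow_mem`).
* `CossartPiltant2019Local.exists_model_of_isGalois_of_isPGroup` — the case of a finite Galois
  extension whose group is a `p`-group (a tower of Galois steps of degree `p`,
  `isNormalPTower_top_of_isGalois_of_isPGroup`): the step `(LU v₀ʳ) ⇒ (LU vʳ)` of the source.
* `CossartPiltant2019Local.exists_model_intermediateField_of_isGalois_of_isPGroup` — the same
  for an intermediate field `K` of such an `L | M` (the shape of `Kʳ = K·Fʳ ≤ K̄` over `Fʳ`),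
  with the root of unity allowed anywhere in `L` (`mem_bot_of_isPrimitiveRoot_of_finrank_eq_pow`:
  it lies in `M`, as `[M(ζ) : M] < p` divides a power of `p`).
* `CossartPiltant2019Local.climb_of_isNormalPTower` — the same from the base `F = Frac S`
  (`S[∅] = S` regular), in the shape of the climbing hypothesis of
  `cossartPiltant2019ReductionP_of_climb` restricted to `K | F` a normal `p`-tower.

With this file every application of Thm. 1.5 in the proof of Prop. 4.10 is formal; what remains
of that proof is the ramification-theoretic frame ([CoP1] §§6–9: Galois approximation,
unramified and tame ascent/descent) and principalization (Prop. 4.4).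

Everything is PROVED; no named facts are introduced (the local theorem enters as the hypothesis
`hloc : CossartPiltant2019Local`).

## Sources

* V. Cossart, O. Piltant, J. Algebra 529 (2019) 268–535 = arXiv:1412.0868: journal Thm. 1.5 and
  proof of Prop. 4.10 (arXiv v1: Thm. 1.4 p. 4; Prop. 4.8, proof pp. 53–54). [CossartPiltant2019]
* S. Lang, *Algebra*, GTM 211 (2002), Ch. VI §6 Thm. 6.2 (Kummer), Thm. 6.4 (Artin–Schreier).
* H. Matsumura, *Commutative Ring Theory*, Cambridge (1986/1989), Thm. 19.4 (regular ⇒ normal). [Matsumura1987]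
-/

noncomputable section

open IsLocalRing Polynomial IntermediateField

namespace Literature.AlgebraicGeometry.Resolution

universe u

/-! ## Normality of the local ring of the model, in the ambient field -/

/-- **Elements of `Frac S[t]` integral over `S[t]` have a `v`-unit denominator** when `S[t]` is
regular at the centre `P` of `v`: the regular local ring `S[t]_P` is normal (Matsumura,
Thm. 19.4), so such an element lies in `S[t]_P`, i.e. is `c/d` with `c ∈ S[t]`, `d ∈ S[t] ∖ P`.
[cite: Matsumura1987, Thm. 19.4] -/
theorem exists_mul_eq_of_isIntegral_of_isRegularLocalRing {S Ω : Type u} [CommRing S] [Field Ω]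
    [Algebra S Ω] (OΩ : ValuationSubring Ω) (t : Set Ω)
    (hTO : (Algebra.adjoin S t).toSubring ≤ OΩ.toSubring)
    (hreg : IsRegularLocalRing (Localization.AtPrime
      (Ideal.comap (Subring.inclusion hTO) (maximalIdeal OΩ))))
    {w : Ω} (hw : w ∈ Subfield.closure (Set.range (algebraMap S Ω) ∪ t))
    (hint : IsIntegral (Algebra.adjoin S t) w) :
    ∃ c d : Ω, c ∈ Algebra.adjoin S t ∧ d ∈ Algebra.adjoin S t ∧ OΩ.valuation d = 1 ∧
      d * w = c := by
  classical
  set P : Ideal (Algebra.adjoin S t) := Ideal.comap (Subring.inclusion hTO) (maximalIdeal OΩ)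
    with hPdef
  haveI : P.IsPrime := Ideal.IsPrime.comap _
  have hPmem : ∀ y : Algebra.adjoin S t, y ∈ P ↔ OΩ.valuation (y : Ω) < 1 := fun y => by
    rw [hPdef, Ideal.mem_comap, ValuationSubring.valuation_lt_one_iff]; rfl
  haveI : IsRegularLocalRing (Localization.AtPrime P) := hreg
  haveI : IsDomain (Localization.AtPrime P) := isDomain_of_isRegularLocalRing _
  haveI : IsIntegrallyClosed (Localization.AtPrime P) := isIntegrallyClosed_of_isRegularLocalRing _
  -- `Frac S[t]` as a type, with `S[t]_P → Frac S[t] → Ω`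
  let K := FractionRing (Algebra.adjoin S t)
  have hunitsK : ∀ y : P.primeCompl, IsUnit (algebraMap (Algebra.adjoin S t) K y) := fun y => by
    refine (IsUnit.mk0 _ (IsFractionRing.to_map_ne_zero_of_mem_nonZeroDivisors
      (mem_nonZeroDivisors_of_ne_zero fun h0 => y.2 ?_)))
    rw [h0]
    exact P.zero_mem
  letI : Algebra (Localization.AtPrime P) K := (IsLocalization.lift (M := P.primeCompl) hunitsK).toAlgebra
  haveI : IsScalarTower (Algebra.adjoin S t) (Localization.AtPrime P) K :=
    IsScalarTower.of_algebraMap_eq fun a => (IsLocalization.lift_eq hunitsK a).symm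
  haveI : IsFractionRing (Localization.AtPrime P) K :=
    IsFractionRing.isFractionRing_of_isDomain_of_isLocalization P.primeCompl _ K
  have hinjT : Function.Injective (Algebra.ofId (Algebra.adjoin S t) Ω) := Subtype.val_injective
  let φ : K →ₐ[Algebra.adjoin S t] Ω := IsFractionRing.liftAlgHom hinjT
  have hφ : ∀ a : Algebra.adjoin S t, φ (algebraMap _ K a) = (a : Ω) := fun a => by
    rw [IsFractionRing.liftAlgHom_apply, IsFractionRing.lift_algebraMap]; rfl
  have hφinj : Function.Injective φ := (φ : K →+* Ω).injective
  -- `w = a / b`, `a, b ∈ S[t]`, pulled back to `Frac S[t]`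
  obtain ⟨a, b, ha, hb, hb0, hwab⟩ := exists_div_eq_of_mem_closure t hw
  let z : K := algebraMap _ K (⟨a, ha⟩ : Algebra.adjoin S t) / algebraMap _ K (⟨b, hb⟩ : Algebra.adjoin S t)
  have hφz : φ z = w := by
    rw [map_div₀, hφ, hφ, hwab]
  have hzint : IsIntegral (Algebra.adjoin S t) z :=
    (isIntegral_algHom_iff φ hφinj).mp (by rw [hφz]; exact hint)
  have hzint' : IsIntegral (Localization.AtPrime P) z := hzint.tower_top
  obtain ⟨y, hy⟩ := IsIntegrallyClosed.isIntegral_iff.mp hzint'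
  obtain ⟨c, d, rfl⟩ := IsLocalization.exists_mk'_eq P.primeCompl y
  have hcd : algebraMap (Localization.AtPrime P) K (IsLocalization.mk' _ c d) *
      algebraMap (Algebra.adjoin S t) K (d : Algebra.adjoin S t) = algebraMap _ K c := by
    rw [IsScalarTower.algebraMap_apply (Algebra.adjoin S t) (Localization.AtPrime P) K
        (d : Algebra.adjoin S t), ← map_mul, IsLocalization.mk'_spec,
      ← IsScalarTower.algebraMap_apply]
  refine ⟨c, (d : Algebra.adjoin S t), c.2, (d : Algebra.adjoin S t).2, ?_, ?_⟩
  · have hd1 : OΩ.valuation ((d : Algebra.adjoin S t) : Ω) ≤ 1 :=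
      (OΩ.valuation_le_one_iff _).mpr (hTO (d : Algebra.adjoin S t).2)
    have hd2 : ¬ OΩ.valuation ((d : Algebra.adjoin S t) : Ω) < 1 := fun hlt => d.2 ((hPmem _).mpr hlt)
    exact le_antisymm hd1 (not_lt.mp hd2)
  · have h1 := congrArg φ hcd
    rw [map_mul, hy, hφz, hφ, hφ, mul_comm] at h1
    exact h1

/-- `M(b·y) = M(y)` for `b ∈ M` non-zero. [folklore] -/
private theorem adjoin_simple_mul_eq_of_mem {Ω : Type u} [Field Ω] (M : Subfield Ω) {b : Ω}
    (hb : b ∈ M) (hb0 : b ≠ 0) (y : Ω) : M⟮b * y⟯ = M⟮y⟯ := by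
  apply le_antisymm
  · rw [adjoin_simple_le_iff]
    exact mul_mem (show ((⟨b, hb⟩ : M) : Ω) ∈ M⟮y⟯ from (M⟮y⟯).algebraMap_mem ⟨b, hb⟩)
      (mem_adjoin_simple_self M y)
  · rw [adjoin_simple_le_iff]
    have h : b⁻¹ * (b * y) ∈ M⟮b * y⟯ :=
      mul_mem (show ((⟨b⁻¹, inv_mem hb⟩ : M) : Ω) ∈ M⟮b * y⟯ from
        (M⟮b * y⟯).algebraMap_mem ⟨b⁻¹, inv_mem hb⟩) (mem_adjoin_simple_self M _)
    rwa [inv_mul_cancel_left₀ hb0] at h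

section Step

variable {S Ω : Type u} [CommRing S] [IsDomain S] [IsLocalRing S] [Field Ω] [Algebra S Ω]
  (OΩ : ValuationSubring Ω)

/-- **The Galois step of degree `p` of the climb** (Cossart–Piltant 2019, proof of Prop. 4.10,
arXiv v1 p. 54: "we may assume `Kʳ|Fʳ` is a single Galois extension of degree `p`. Let `x` be a
primitive element with minimal polynomial `h ∈ O[X]` … we may take `fᵢ ∈ Tʳ` … Theorem 1.5 (ii)
states that `(LU vʳ)` holds"). Data: climbing data at a subfield `M ∋ S` of `Ω` (a model
`S[t] ⊆ O_Ω`, `t ⊆ M ⊆ Frac(S)(t)`, regular at the centre) and `M₁ | M` Galois of degree `p`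
inside `Ω`, with `char Ω = p` or a primitive `p`-th root of unity in `M`. Conclusion: climbing
data at `M₁`. The primitive element is an Artin–Schreier generator (`ϑ^p − ϑ ∈ M`, `σϑ = ϑ + i`,
Lang VI Thm. 6.4) in the first case and a Kummer generator (`ϑ^p ∈ M`, `σϑ = ζ^i ϑ`) in the
second, rescaled by a denominator from `S[t]` so that `h ∈ S[t][X]`; then `S[t]_P[x]` is stable
under `Gal(M₁|M)` (in the Kummer case because `ζ^i ∈ S[t]_P` by normality of the regular local
ring `S[t]_P`), and `CossartPiltant2019Local.exists_model_adjoin_of_step` (ii) applies.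
[cite: CossartPiltant2019, proof of Prop. 4.10 (arXiv v1: Prop. 4.8, p. 54) with Thm. 1.5 (ii)] -/
theorem CossartPiltant2019Local.exists_model_of_isGalois_of_finrank_eq
    (hloc : CossartPiltant2019Local.{u}) (p : ℕ) [hp : Fact p.Prime] [Algebra.IsAlgebraic S Ω]
    (hinj : Function.Injective (algebraMap S Ω))
    (hS : IsExcellentRing S) (hSdim : ringKrullDim S = 3) (hSchar : CharP (ResidueField S) p)
    (hSO : ∀ s : S, algebraMap S Ω s ∈ OΩ)
    (hdom : ∀ s ∈ maximalIdeal S, OΩ.valuation (algebraMap S Ω s) < 1)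
    (hres : ∀ y : OΩ, ∃ q : S[X], (∃ i, q.coeff i ∉ maximalIdeal S) ∧
      OΩ.valuation (q.eval₂ (algebraMap S Ω) y) < 1)
    (M : Subfield Ω) (hSM : ∀ s : S, algebraMap S Ω s ∈ M)
    (t : Finset Ω) (htM : (t : Set Ω) ⊆ M)
    (hMcl : M ≤ Subfield.closure (Set.range (algebraMap S Ω) ∪ (t : Set Ω)))
    (hTO : (Algebra.adjoin S (t : Set Ω)).toSubring ≤ OΩ.toSubring)
    (hreg : IsRegularLocalRing (Localization.AtPrime
      (Ideal.comap (Subring.inclusion hTO) (maximalIdeal OΩ))))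
    (M₁ : IntermediateField M Ω) [FiniteDimensional M M₁] [IsGalois M M₁]
    (hdeg : Module.finrank M M₁ = p)
    (hζ : CharP Ω p ∨ ∃ ζ ∈ M, IsPrimitiveRoot ζ p) :
    ∃ t' : Finset Ω,
      (t' : Set Ω) ⊆ M₁.toSubfield ∧
      M₁.toSubfield ≤ Subfield.closure (Set.range (algebraMap S Ω) ∪ (t' : Set Ω)) ∧
      ∃ hTO' : (Algebra.adjoin S (t' : Set Ω)).toSubring ≤ OΩ.toSubring,
        IsRegularLocalRing (Localization.AtPrime
          (Ideal.comap (Subring.inclusion hTO') (maximalIdeal OΩ))) := by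
  classical
  have hp' : p.Prime := hp.out
  have hTM : ∀ w ∈ Algebra.adjoin S (t : Set Ω), w ∈ M := by
    intro w hw
    refine Algebra.adjoin_induction (p := fun w _ => w ∈ M) (fun w hw => htM hw) (fun s => hSM s)
      (fun _ _ _ _ hx hy => add_mem hx hy) (fun _ _ _ _ hx hy => mul_mem hx hy) hw
  -- reduction to step data `(x, h₀)` with `M(x) = M₁` and `σ`-stability
  suffices H : ∃ (x : Ω) (h₀ : (Algebra.adjoin S (t : Set Ω))[X]), M⟮x⟯ = M₁ ∧ h₀.Monic ∧
      h₀.natDegree = p ∧ aeval x h₀ = 0 ∧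
      ∀ σ : M⟮x⟯ ≃ₐ[M] M⟮x⟯,
        ∃ (g : (Algebra.adjoin S (t : Set Ω))[X]) (b : Algebra.adjoin S (t : Set Ω)),
          OΩ.valuation (b : Ω) = 1 ∧
          (b : Ω) * ((σ (AdjoinSimple.gen M x) : M⟮x⟯) : Ω) = aeval x g by
    obtain ⟨x, h₀, hx, hmon, hdeg₀, hx0, hstab⟩ := H
    subst hx
    have hcard : Nat.card (M⟮x⟯ ≃ₐ[M] M⟮x⟯) = p := by rw [IsGalois.card_aut_eq_finrank, hdeg]
    exact CossartPiltant2019Local.exists_model_adjoin_of_step OΩ hloc p hinj hS hSdim hSchar hSO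
      hdom hres M hSM t htM hMcl hTO hreg x h₀ hmon hdeg₀ hx0 hdeg (Or.inr ⟨hcard, hstab⟩)
  -- exponent bookkeeping `p = n + 1`
  obtain ⟨n, hn⟩ : ∃ n, p = n + 1 := ⟨p - 1, (Nat.sub_one_add_one hp'.ne_zero).symm⟩
  rcases hζ with hchar | ⟨ζ, hζM, hζ⟩
  · /- Artin–Schreier generator -/
    haveI := hchar
    haveI : CharP M p := inferInstance
    obtain ⟨ϑ, -, ⟨a, ha⟩, hMϑ⟩ :=
      Literature.FieldTheory.ArtinSchreier.IntermediateField.exists_generator_pow_sub_self_mem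
        M₁ hdeg
    -- `a = a₁ / b₁` with `a₁, b₁ ∈ S[t]`; the rescaled generator `x := b₁ ϑ`
    obtain ⟨a₁, b₁, ha₁, hb₁, hb₁0, hab⟩ := exists_div_eq_of_mem_closure (t : Set Ω) (hMcl a.2)
    have hb₁M : b₁ ∈ M := hTM b₁ hb₁
    have hϑp : ϑ ^ p - ϑ = a₁ / b₁ := by rw [← hab, ← ha]; rfl
    set x : Ω := b₁ * ϑ with hxdef
    have hxϑ : M⟮x⟯ = M⟮ϑ⟯ := adjoin_simple_mul_eq_of_mem M hb₁M hb₁0 ϑ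
    -- `h₀ = X^p − b₁^{p-1} X − b₁^{p-1} a₁ ∈ S[t][X]`
    let β : Algebra.adjoin S (t : Set Ω) := ⟨b₁ ^ n, pow_mem hb₁ n⟩
    let γ : Algebra.adjoin S (t : Set Ω) := ⟨b₁ ^ n * a₁, mul_mem (pow_mem hb₁ n) ha₁⟩
    have hβ : algebraMap (Algebra.adjoin S (t : Set Ω)) Ω β = b₁ ^ n := rfl
    have hγ : algebraMap (Algebra.adjoin S (t : Set Ω)) Ω γ = b₁ ^ n * a₁ := rfl
    have hle1 : (C β * X + C γ).degree ≤ 1 :=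
      (degree_add_le _ _).trans (max_le (degree_C_mul_X_le _) (degree_C_le.trans zero_le_one))
    have hlt : (C β * X + C γ).degree < (p : WithBot ℕ) :=
      hle1.trans_lt (by exact_mod_cast hp'.one_lt)
    have hmon : (X ^ p - (C β * X + C γ)).Monic := monic_X_pow_sub hlt
    have hdeg₀ : (X ^ p - (C β * X + C γ)).natDegree = p := by
      rw [natDegree_sub_eq_left_of_natDegree_lt, natDegree_X_pow]
      rw [natDegree_X_pow]
      calc (C β * X + C γ).natDegree ≤ 1 := natDegree_le_iff_degree_le.mpr hle1
        _ < p := hp'.one_lt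
    have hϑp' : ϑ ^ p = ϑ + a₁ / b₁ := by rw [← hϑp]; ring
    have hx0 : aeval x (X ^ p - (C β * X + C γ)) = 0 := by
      rw [map_sub, map_add, map_mul, aeval_X_pow, aeval_X, aeval_C, aeval_C, hβ, hγ, hxdef, mul_pow,
        hϑp', hn, pow_succ]
      field_simp
      ring
    refine ⟨x, X ^ p - (C β * X + C γ), hxϑ.trans hMϑ, hmon, hdeg₀, hx0, fun σ => ?_⟩
    -- `σ ϑ = ϑ + i`, hence `σ x = x + i b₁`
    have hϑx : ϑ ∈ M⟮x⟯ := by rw [hxϑ]; exact mem_adjoin_simple_self M ϑ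
    let ϑL : M⟮x⟯ := ⟨ϑ, hϑx⟩
    let σ' : M⟮x⟯ →ₐ[M] Ω := (M⟮x⟯.val).comp (σ : M⟮x⟯ →ₐ[M] M⟮x⟯)
    have hσ' : ∀ z : M⟮x⟯, σ' z = ((σ z : M⟮x⟯) : Ω) := fun _ => rfl
    have h1 : ϑL ^ p - ϑL = algebraMap M M⟮x⟯ a := by
      apply Subtype.ext
      rw [coe_algebraMap_apply]
      change ϑ ^ p - ϑ = algebraMap M Ω a
      exact ha.symm
    have hu : (σ' ϑL) ^ p - σ' ϑL = ϑ ^ p - ϑ := by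
      have h2 := congrArg σ' h1
      rw [map_sub, map_pow, AlgHom.commutes] at h2
      rw [h2]
      exact ha
    have hs : (σ' ϑL - ϑ) ^ p = σ' ϑL - ϑ := by
      rw [sub_pow_char]
      linear_combination hu
    obtain ⟨i, -, hi⟩ :=
      Literature.FieldTheory.ArtinSchreier.exists_natCast_eq_of_pow_eq_self p hs
    have hσϑ : σ' ϑL = ϑ + i := by rw [hi]; ring
    have hgen : AdjoinSimple.gen M x = algebraMap M M⟮x⟯ ⟨b₁, hb₁M⟩ * ϑL := by
      apply Subtype.ext
      rw [AdjoinSimple.coe_gen, MulMemClass.coe_mul, coe_algebraMap_apply]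
      change x = b₁ * ϑ
      exact hxdef
    refine ⟨X + C ⟨(i : Ω) * b₁, mul_mem (natCast_mem _ i) hb₁⟩, 1, by simp, ?_⟩
    rw [OneMemClass.coe_one, one_mul, ← hσ', hgen, map_mul, AlgHom.commutes, hσϑ, map_add, aeval_X,
      aeval_C]
    change (b₁ : Ω) * (ϑ + i) = x + (i : Ω) * b₁
    rw [hxdef]
    ring
  · /- Kummer generator -/
    haveI : NeZero p := ⟨hp'.ne_zero⟩
    have hcardM₁ : Nat.card (M₁ ≃ₐ[M] M₁) = p := by rw [IsGalois.card_aut_eq_finrank, hdeg]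
    haveI : IsCyclic (M₁ ≃ₐ[M] M₁) := isCyclic_of_prime_card hcardM₁
    have hζ' : IsPrimitiveRoot (⟨ζ, hζM⟩ : M) p :=
      (IsPrimitiveRoot.map_iff_of_injective (f := algebraMap M Ω) (algebraMap M Ω).injective).mp hζ
    have hK : (primitiveRoots (Module.finrank M M₁) M).Nonempty :=
      ⟨⟨ζ, hζM⟩, by rw [hdeg, mem_primitiveRoots hp'.pos]; exact hζ'⟩
    obtain ⟨α, ⟨a, ha⟩, hMα⟩ := exists_root_adjoin_eq_top_of_isCyclic M M₁ hK
    rw [hdeg] at ha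
    have hMϑ : M⟮(α : Ω)⟯ = M₁ := by
      have h := congrArg (IntermediateField.lift (F := M₁)) hMα
      rw [lift_adjoin_simple, lift_top] at h
      exact h
    have hαp : (α : Ω) ^ p = (a : Ω) := by
      have h1 := congrArg (fun z : M₁ => (z : Ω)) ha
      simp only [coe_algebraMap_apply, SubmonoidClass.coe_pow] at h1
      exact h1.symm
    -- `a = a₁ / b₁` with `a₁, b₁ ∈ S[t]`; the rescaled generator `x := b₁ α`, `x^p ∈ S[t]`
    obtain ⟨a₁, b₁, ha₁, hb₁, hb₁0, hab⟩ := exists_div_eq_of_mem_closure (t : Set Ω) (hMcl a.2)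
    have hb₁M : b₁ ∈ M := hTM b₁ hb₁
    set x : Ω := b₁ * (α : Ω) with hxdef
    have hxϑ : M⟮x⟯ = M⟮(α : Ω)⟯ := adjoin_simple_mul_eq_of_mem M hb₁M hb₁0 _
    have hxM₁ : M⟮x⟯ = M₁ := hxϑ.trans hMϑ
    have hxp : x ^ p = b₁ ^ n * a₁ := by
      rw [hxdef, mul_pow, hαp, hab, hn, pow_succ]
      field_simp
    have hxpT : x ^ p ∈ Algebra.adjoin S (t : Set Ω) := by
      rw [hxp]; exact mul_mem (pow_mem hb₁ n) ha₁
    let c₀ : Algebra.adjoin S (t : Set Ω) := ⟨x ^ p, hxpT⟩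
    have hc₀ : algebraMap (Algebra.adjoin S (t : Set Ω)) Ω c₀ = x ^ p := rfl
    have hmon : (X ^ p - C c₀).Monic := monic_X_pow_sub_C c₀ hp'.ne_zero
    have hdeg₀ : (X ^ p - C c₀).natDegree = p := natDegree_X_pow_sub_C
    have hx0 : aeval x (X ^ p - C c₀) = 0 := by
      rw [map_sub, aeval_X_pow, aeval_C, hc₀, sub_self]
    have hxM : x ∉ M := by
      intro hxM
      have hbot : M⟮x⟯ = ⊥ :=
        adjoin_simple_eq_bot_iff.mpr (IntermediateField.mem_bot.mpr ⟨⟨x, hxM⟩, rfl⟩)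
      have h1 : Module.finrank M M⟮x⟯ = 1 := by rw [hbot, IntermediateField.finrank_bot]
      rw [hxM₁, hdeg] at h1
      exact hp'.one_lt.ne' h1
    have hx_ne : x ≠ 0 := fun h => hxM (h ▸ zero_mem M)
    refine ⟨x, X ^ p - C c₀, hxM₁, hmon, hdeg₀, hx0, fun σ => ?_⟩
    -- `σ x = ξ x` with `ξ^p = 1`, so `ξ = ζ^i ∈ M`, and `ξ = c / d` with `d` a `v`-unit of `S[t]`
    let σ' : M⟮x⟯ →ₐ[M] Ω := (M⟮x⟯.val).comp (σ : M⟮x⟯ →ₐ[M] M⟮x⟯)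
    have hσ' : ∀ z : M⟮x⟯, σ' z = ((σ z : M⟮x⟯) : Ω) := fun _ => rfl
    set u : Ω := σ' (AdjoinSimple.gen M x) with hudef
    have hup : u ^ p = x ^ p := by
      have h1 : (AdjoinSimple.gen M x) ^ p = algebraMap M M⟮x⟯ ⟨x ^ p, hTM _ hxpT⟩ := by
        apply Subtype.ext
        rw [coe_algebraMap_apply, SubmonoidClass.coe_pow, AdjoinSimple.coe_gen]
        rfl
      rw [hudef, ← map_pow, h1, AlgHom.commutes]
      rfl
    set ξ : Ω := u / x with hξdef
    have hξp : ξ ^ p = 1 := by rw [hξdef, div_pow, hup, div_self (pow_ne_zero _ hx_ne)]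
    obtain ⟨i, -, hi⟩ := hζ.eq_pow_of_pow_eq_one hξp
    have hξM : ξ ∈ M := by rw [← hi]; exact pow_mem hζM i
    have hξint : IsIntegral (Algebra.adjoin S (t : Set Ω)) ξ :=
      IsIntegral.of_pow hp'.pos (by rw [hξp]; exact isIntegral_one)
    obtain ⟨c, d, hc, hd, hd1, hdξ⟩ :=
      exists_mul_eq_of_isIntegral_of_isRegularLocalRing OΩ (t : Set Ω) hTO hreg (hMcl hξM) hξint
    refine ⟨C ⟨c, hc⟩ * X, ⟨d, hd⟩, hd1, ?_⟩
    rw [← hσ', ← hudef, map_mul, aeval_C, aeval_X]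
    change d * u = c * x
    have hu : u = ξ * x := by rw [hξdef, div_mul_cancel₀ u hx_ne]
    rw [hu, ← mul_assoc, hdξ]

end Step

/-! ## Towers of normal extensions of degree `p` -/

section Tower

variable {S Ω : Type u} [CommRing S] [IsDomain S] [IsLocalRing S] [Field Ω] [Algebra S Ω]
  (OΩ : ValuationSubring Ω)

/-- **Climbing a finite tower of normal extensions of degree `p`** (Cossart–Piltant 2019, proof
of Prop. 4.10, arXiv v1 p. 54: along `K ⊇ K^{sep}` by Thm. 1.5 (i) and along "`Kʳ|Fʳ`, a tower
of Galois extensions of degree `p`" by Thm. 1.5 (ii)). For subfields `M ≤ E` of `Ω` with `S ⊆ M`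
and `E` reached from `M` by a finite tower of normal extensions of degree `p` (`IsNormalPTower`),
in characteristic `p`, or in characteristic `0` with a primitive `p`-th root of unity in `M`:
climbing data at `M` yield climbing data at `E`. A normal step of the prime degree `p` is either
separable, hence Galois (`CossartPiltant2019Local.exists_model_of_isGalois_of_finrank_eq`), or
else — its separable closure being a proper subextension of degree dividing `p` — purely
inseparable, which forces characteristic `p`
(`CossartPiltant2019Local.exists_model_of_forall_pow_mem`).
[cite: CossartPiltant2019, proof of Prop. 4.10 (arXiv v1: Prop. 4.8, p. 54) with Thm. 1.5] -/
theorem CossartPiltant2019Local.exists_model_of_isNormalPTower (hloc : CossartPiltant2019Local.{u})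
    (p : ℕ) [hp : Fact p.Prime] [Algebra.IsAlgebraic S Ω]
    (hinj : Function.Injective (algebraMap S Ω))
    (hS : IsExcellentRing S) (hSdim : ringKrullDim S = 3) (hSchar : CharP (ResidueField S) p)
    (hSO : ∀ s : S, algebraMap S Ω s ∈ OΩ)
    (hdom : ∀ s ∈ maximalIdeal S, OΩ.valuation (algebraMap S Ω s) < 1)
    (hres : ∀ y : OΩ, ∃ q : S[X], (∃ i, q.coeff i ∉ maximalIdeal S) ∧
      OΩ.valuation (q.eval₂ (algebraMap S Ω) y) < 1)
    {M E : Subfield Ω} (htower : IsNormalPTower p M E) :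
    (∀ s : S, algebraMap S Ω s ∈ M) →
    (CharP Ω p ∨ (CharZero Ω ∧ ∃ ζ ∈ M, IsPrimitiveRoot ζ p)) →
    (∃ t : Finset Ω, (t : Set Ω) ⊆ M ∧
      M ≤ Subfield.closure (Set.range (algebraMap S Ω) ∪ (t : Set Ω)) ∧
      ∃ hTO : (Algebra.adjoin S (t : Set Ω)).toSubring ≤ OΩ.toSubring,
        IsRegularLocalRing (Localization.AtPrime
          (Ideal.comap (Subring.inclusion hTO) (maximalIdeal OΩ)))) →
    ∃ t : Finset Ω, (t : Set Ω) ⊆ E ∧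
      E ≤ Subfield.closure (Set.range (algebraMap S Ω) ∪ (t : Set Ω)) ∧
      ∃ hTO : (Algebra.adjoin S (t : Set Ω)).toSubring ≤ OΩ.toSubring,
        IsRegularLocalRing (Localization.AtPrime
          (Ideal.comap (Subring.inclusion hTO) (maximalIdeal OΩ))) := by
  classical
  induction htower with
  | refl M => exact fun _ _ h => h
  | @step M M₁ T hstep _ ih =>
    intro hSM hchar hINV
    obtain ⟨hle, hdegp, hnormal⟩ := hstep
    -- climbing data at `M₁`
    have hINV₁ : ∃ t : Finset Ω, (t : Set Ω) ⊆ M₁ ∧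
        M₁ ≤ Subfield.closure (Set.range (algebraMap S Ω) ∪ (t : Set Ω)) ∧
        ∃ hTO : (Algebra.adjoin S (t : Set Ω)).toSubring ≤ OΩ.toSubring,
          IsRegularLocalRing (Localization.AtPrime
            (Ideal.comap (Subring.inclusion hTO) (maximalIdeal OΩ))) := by
      obtain ⟨t, htM, hMcl, hTO, hreg⟩ := hINV
      haveI : FiniteDimensional M (Subfield.extendScalars hle) :=
        Module.finite_of_finrank_pos (by rw [hdegp]; exact hp.out.pos)
      haveI := hnormal
      by_cases hsep : Algebra.IsSeparable M (Subfield.extendScalars hle)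
      · -- a Galois step
        haveI : IsGalois M (Subfield.extendScalars hle) := isGalois_iff.mpr ⟨hsep, hnormal⟩
        have h := CossartPiltant2019Local.exists_model_of_isGalois_of_finrank_eq OΩ hloc p hinj hS
          hSdim hSchar hSO hdom hres M hSM t htM hMcl hTO hreg (Subfield.extendScalars hle) hdegp
          (hchar.imp_right fun h => h.2)
        rwa [Subfield.extendScalars_toSubfield] at h
      · -- an inseparable step of prime degree is purely inseparable, in characteristic `p`
        have hcharp : CharP Ω p := by
          rcases hchar with h | ⟨h0, -⟩
          · exact h
          · exfalso
            haveI := h0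
            exact hsep inferInstance
        haveI := hcharp
        haveI : CharP M p := inferInstance
        haveI : ExpChar M p := ExpChar.prime hp.out
        have hsc : separableClosure M (Subfield.extendScalars hle) = ⊥ := by
          have hdvd : Module.finrank M (separableClosure M (Subfield.extendScalars hle)) ∣ p := by
            rw [← hdegp, ← IntermediateField.finrank_top' (F := M) (E := Subfield.extendScalars hle)]
            exact IntermediateField.finrank_dvd_of_le_right le_top
          rcases (Nat.dvd_prime hp.out).mp hdvd with h1 | h2
          · exact IntermediateField.finrank_eq_one_iff.mp h1
          · exfalso
            apply hsep
            rw [← separableClosure.eq_top_iff]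
            exact IntermediateField.eq_of_le_of_finrank_eq le_top
              (by rw [h2, IntermediateField.finrank_top', hdegp])
        haveI : IsPurelyInseparable M (Subfield.extendScalars hle) :=
          separableClosure.eq_bot_iff.mp hsc
        have hpow : ∀ z ∈ M₁, ∃ k : ℕ, z ^ p ^ k ∈ M := fun z hz => by
          obtain ⟨k, c, hc⟩ :=
            IsPurelyInseparable.pow_mem M p (⟨z, (Subfield.mem_extendScalars hle).mpr hz⟩ :
              Subfield.extendScalars hle)
          refine ⟨k, ?_⟩
          have h1 := congrArg (fun w : Subfield.extendScalars hle => (w : Ω)) hc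
          simp only [coe_algebraMap_apply, SubmonoidClass.coe_pow] at h1
          change algebraMap M Ω c = z ^ p ^ k at h1
          rw [← h1]
          exact c.2
        exact CossartPiltant2019Local.exists_model_of_forall_pow_mem OΩ hloc p hinj hS hSdim hSchar
          hSO hdom hres _ M M₁ hle hSM hpow rfl
          (by rw [Subfield.relfinrank_eq_finrank_of_le hle, hdegp]; exact hp.out.pos)
          ⟨t, htM, hMcl, hTO, hreg⟩
    -- continue along the tower from `M₁`
    exact ih (fun s => hle (hSM s))
      (hchar.imp_right fun ⟨h0, ζ, hζM, hζ⟩ => ⟨h0, ζ, hle hζM, hζ⟩) hINV₁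

/-- **`(LU v₀ʳ) ⇒ (LU vʳ)` along a Galois extension with `p`-group Galois group**
(Cossart–Piltant 2019, proof of Prop. 4.10, arXiv v1 p. 54: "`Kʳ|Fʳ` is a tower of Galois
extensions of degree `p`" — `Gal(K̄|Fʳ)` is the ramification group, a `p`-group — "… Theorem
1.5 (ii) states that `(LU vʳ)` holds"): for `L | M` finite Galois inside `Ω` with `Gal(L|M)` a
`p`-group, in characteristic `p` or in characteristic `0` with `ζ_p ∈ M`, climbing data at `M`
yield climbing data at `L` (`isNormalPTower_top_of_isGalois_of_isPGroup` and
`CossartPiltant2019Local.exists_model_of_isNormalPTower`).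
[cite: CossartPiltant2019, proof of Prop. 4.10 (arXiv v1: Prop. 4.8, p. 54) with Thm. 1.5 (ii)] -/
theorem CossartPiltant2019Local.exists_model_of_isGalois_of_isPGroup
    (hloc : CossartPiltant2019Local.{u}) (p : ℕ) [hp : Fact p.Prime] [Algebra.IsAlgebraic S Ω]
    (hinj : Function.Injective (algebraMap S Ω))
    (hS : IsExcellentRing S) (hSdim : ringKrullDim S = 3) (hSchar : CharP (ResidueField S) p)
    (hSO : ∀ s : S, algebraMap S Ω s ∈ OΩ)
    (hdom : ∀ s ∈ maximalIdeal S, OΩ.valuation (algebraMap S Ω s) < 1)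
    (hres : ∀ y : OΩ, ∃ q : S[X], (∃ i, q.coeff i ∉ maximalIdeal S) ∧
      OΩ.valuation (q.eval₂ (algebraMap S Ω) y) < 1)
    (M : Subfield Ω) (hSM : ∀ s : S, algebraMap S Ω s ∈ M)
    (L : IntermediateField M Ω) [FiniteDimensional M L] [IsGalois M L]
    (hG : IsPGroup p (L ≃ₐ[M] L))
    (hchar : CharP Ω p ∨ (CharZero Ω ∧ ∃ ζ ∈ M, IsPrimitiveRoot ζ p))
    (hINV : ∃ t : Finset Ω, (t : Set Ω) ⊆ M ∧
      M ≤ Subfield.closure (Set.range (algebraMap S Ω) ∪ (t : Set Ω)) ∧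
      ∃ hTO : (Algebra.adjoin S (t : Set Ω)).toSubring ≤ OΩ.toSubring,
        IsRegularLocalRing (Localization.AtPrime
          (Ideal.comap (Subring.inclusion hTO) (maximalIdeal OΩ)))) :
    ∃ t : Finset Ω, (t : Set Ω) ⊆ L.toSubfield ∧
      L.toSubfield ≤ Subfield.closure (Set.range (algebraMap S Ω) ∪ (t : Set Ω)) ∧
      ∃ hTO : (Algebra.adjoin S (t : Set Ω)).toSubring ≤ OΩ.toSubring,
        IsRegularLocalRing (Localization.AtPrime
          (Ideal.comap (Subring.inclusion hTO) (maximalIdeal OΩ))) :=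
  CossartPiltant2019Local.exists_model_of_isNormalPTower OΩ hloc p hinj hS hSdim hSchar hSO hdom
    hres (isNormalPTower_top_of_isGalois_of_isPGroup M L hG) hSM hchar hINV

end Tower

/-! ## The root of unity lies at the bottom of a `p`-tower -/

/-- **A primitive `p`-th root of unity in an extension of `p`-power degree lies in the base**:
`[F(ζ) : F]` divides `p^k` and is at most `φ(p) = p − 1 < p`. (Used for `ζ_p ∈ Fʳ` in the
Kummer steps along `Kʳ | Fʳ`: `K̄ | Fʳ` is a `p`-extension.) [folklore] -/
theorem mem_bot_of_isPrimitiveRoot_of_finrank_eq_pow {F E : Type*} [Field F] [Field E]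
    [Algebra F E] [FiniteDimensional F E] {p k : ℕ} (hp : p.Prime)
    (hdeg : Module.finrank F E = p ^ k) {ζ : E} (hζ : IsPrimitiveRoot ζ p) :
    ζ ∈ (⊥ : IntermediateField F E) := by
  have hint : IsIntegral F ζ := IsIntegral.of_finite F ζ
  -- `[F(ζ) : F] = p^j`
  have hdvd : Module.finrank F F⟮ζ⟯ ∣ p ^ k := by
    rw [← hdeg, ← IntermediateField.finrank_top' (F := F) (E := E)]
    exact IntermediateField.finrank_dvd_of_le_right le_top
  obtain ⟨j, -, hj⟩ := (Nat.dvd_prime_pow hp).mp hdvd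
  -- `[F(ζ) : F] ≤ p − 1`
  have hle : Module.finrank F F⟮ζ⟯ ≤ p - 1 := by
    rw [IntermediateField.adjoin.finrank hint]
    have hroot : aeval ζ (cyclotomic p F) = 0 := by
      rw [aeval_def, ← eval_map, map_cyclotomic]
      exact hζ.isRoot_cyclotomic hp.pos
    have h1 := natDegree_le_of_dvd (minpoly.dvd F ζ hroot) (cyclotomic_ne_zero p F)
    rwa [natDegree_cyclotomic, Nat.totient_prime hp] at h1
  have hj0 : j = 0 := by
    by_contra hj0
    have h2 : p ≤ p ^ j := by
      calc p = p ^ 1 := (pow_one p).symm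
        _ ≤ p ^ j := Nat.pow_le_pow_right hp.pos (Nat.one_le_iff_ne_zero.mpr hj0)
    rw [hj] at hle
    have h3 := hp.two_le
    omega
  rw [hj0, pow_zero] at hj
  rw [← IntermediateField.adjoin_simple_eq_bot_iff, ← IntermediateField.finrank_eq_one_iff]
  exact hj

section TowerIntermediate

variable {S Ω : Type u} [CommRing S] [IsDomain S] [IsLocalRing S] [Field Ω] [Algebra S Ω]
  (OΩ : ValuationSubring Ω)

/-- **`(LU v₀ʳ) ⇒ (LU vʳ)` for an intermediate field of a Galois extension with `p`-group Galois
group** (Cossart–Piltant 2019, proof of Prop. 4.10, arXiv v1 p. 54: `Kʳ = K·Fʳ` is an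
intermediate field of `K̄ | Fʳ`, whose group `Gʳ` is a `p`-group, so "`Kʳ|Fʳ` is a tower of
Galois extensions of degree `p`" — `isNormalPTower_of_isGalois_of_isPGroup`): for `L | M` finite
Galois inside `Ω` with `Gal(L|M)` a `p`-group and `K` an intermediate field, in characteristic
`p` or in characteristic `0` with a primitive `p`-th root of unity in `L` (it then lies in `M`,
`mem_bot_of_isPrimitiveRoot_of_finrank_eq_pow`), climbing data at `M` yield climbing data at
`K`. [cite: CossartPiltant2019, proof of Prop. 4.10 (arXiv v1: Prop. 4.8, p. 54) with Thm. 1.5 (ii)] -/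
theorem CossartPiltant2019Local.exists_model_intermediateField_of_isGalois_of_isPGroup
    (hloc : CossartPiltant2019Local.{u}) (p : ℕ) [hp : Fact p.Prime] [Algebra.IsAlgebraic S Ω]
    (hinj : Function.Injective (algebraMap S Ω))
    (hS : IsExcellentRing S) (hSdim : ringKrullDim S = 3) (hSchar : CharP (ResidueField S) p)
    (hSO : ∀ s : S, algebraMap S Ω s ∈ OΩ)
    (hdom : ∀ s ∈ maximalIdeal S, OΩ.valuation (algebraMap S Ω s) < 1)
    (hres : ∀ y : OΩ, ∃ q : S[X], (∃ i, q.coeff i ∉ maximalIdeal S) ∧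
      OΩ.valuation (q.eval₂ (algebraMap S Ω) y) < 1)
    (M : Subfield Ω) (hSM : ∀ s : S, algebraMap S Ω s ∈ M)
    (L : IntermediateField M Ω) [FiniteDimensional M L] [IsGalois M L]
    (hG : IsPGroup p (L ≃ₐ[M] L)) (K : IntermediateField M L)
    (hchar : CharP Ω p ∨ (CharZero Ω ∧ ∃ ζ ∈ L, IsPrimitiveRoot ζ p))
    (hINV : ∃ t : Finset Ω, (t : Set Ω) ⊆ M ∧
      M ≤ Subfield.closure (Set.range (algebraMap S Ω) ∪ (t : Set Ω)) ∧
      ∃ hTO : (Algebra.adjoin S (t : Set Ω)).toSubring ≤ OΩ.toSubring,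
        IsRegularLocalRing (Localization.AtPrime
          (Ideal.comap (Subring.inclusion hTO) (maximalIdeal OΩ)))) :
    ∃ t : Finset Ω, (t : Set Ω) ⊆ (IntermediateField.lift K).toSubfield ∧
      (IntermediateField.lift K).toSubfield ≤
        Subfield.closure (Set.range (algebraMap S Ω) ∪ (t : Set Ω)) ∧
      ∃ hTO : (Algebra.adjoin S (t : Set Ω)).toSubring ≤ OΩ.toSubring,
        IsRegularLocalRing (Localization.AtPrime
          (Ideal.comap (Subring.inclusion hTO) (maximalIdeal OΩ))) := by
  refine CossartPiltant2019Local.exists_model_of_isNormalPTower OΩ hloc p hinj hS hSdim hSchar hSO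
    hdom hres (isNormalPTower_of_isGalois_of_isPGroup (Module.finrank M L) M L hG rfl K) hSM
    ?_ hINV
  refine hchar.imp_right fun ⟨h0, ζ, hζL, hζ⟩ => ⟨h0, ζ, ?_, hζ⟩
  -- `ζ ∈ M`: `[L : M] = |Gal(L|M)|` is a power of `p`
  obtain ⟨k, hk⟩ := hG.exists_card_eq
  rw [IsGalois.card_aut_eq_finrank] at hk
  have hζ' : IsPrimitiveRoot (⟨ζ, hζL⟩ : L) p :=
    (IsPrimitiveRoot.map_iff_of_injective (f := algebraMap L Ω) (algebraMap L Ω).injective).mp hζ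
  obtain ⟨c, hc⟩ := IntermediateField.mem_bot.mp
    (mem_bot_of_isPrimitiveRoot_of_finrank_eq_pow hp.out hk hζ')
  have h1 := congrArg (fun z : L => (z : Ω)) hc
  simp only [coe_algebraMap_apply] at h1
  rw [← h1]
  exact c.2

end TowerIntermediate

/-- **The normal `p`-tower part of Cossart–Piltant's climb, in the shape of the climbing
hypothesis of `cossartPiltant2019ReductionP_of_climb`** (`ArithmeticalThreefoldsReduction.lean`):
for `S` an excellent regular local domain of dimension three and residue characteristic `p`,
`Ω ⊇ S` algebraic over `S`, `O_Ω ∋ S` a valuation ring dominating `S` with residue field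
algebraic over `S/𝔪_S`, and a finite `s₀ ⊆ Ω` such that `K = F(s₀)` is reached from
`F = Frac S` by a finite tower of normal extensions of degree `p` — in characteristic `p`, or in
characteristic `0` with `ζ_p ∈ F` —: there is a model `S[t] ⊆ O_Ω` with `t ⊆ K ⊆ F(t)` regular at
the centre of `O_Ω` (base `S[∅] = S`, then `CossartPiltant2019Local.exists_model_of_isNormalPTower`).
This covers the purely inseparable tower `K ⊇ K^{sep}` and the `p`-part `Kʳ ⊇ Fʳ` of the source;
the prime-to-`p` (tame) and unramified parts of the climb are [CoP1] §§6–9, not treated here.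
[cite: CossartPiltant2019, proof of Prop. 4.10 (arXiv v1: Prop. 4.8, p. 54) with Thm. 1.5] -/
theorem CossartPiltant2019Local.climb_of_isNormalPTower {S Ω : Type u} [CommRing S]
    [IsRegularLocalRing S] [Field Ω] [Algebra S Ω] (OΩ : ValuationSubring Ω)
    (hloc : CossartPiltant2019Local.{u}) (p : ℕ) [hp : Fact p.Prime]
    [Algebra.IsAlgebraic S Ω] (hinj : Function.Injective (algebraMap S Ω))
    (hS : IsExcellentRing S) (hSdim : ringKrullDim S = 3) (hSchar : CharP (ResidueField S) p)
    (hSO : ∀ s : S, algebraMap S Ω s ∈ OΩ)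
    (hdom : ∀ s ∈ maximalIdeal S, OΩ.valuation (algebraMap S Ω s) < 1)
    (hres : ∀ y : OΩ, ∃ q : S[X], (∃ i, q.coeff i ∉ maximalIdeal S) ∧
      OΩ.valuation (q.eval₂ (algebraMap S Ω) y) < 1)
    (s₀ : Finset Ω)
    (htower : IsNormalPTower p (Subfield.closure (Set.range (algebraMap S Ω)))
      (Subfield.closure (Set.range (algebraMap S Ω) ∪ (s₀ : Set Ω))))
    (hchar : CharP Ω p ∨ (CharZero Ω ∧
      ∃ ζ ∈ Subfield.closure (Set.range (algebraMap S Ω)), IsPrimitiveRoot ζ p)) :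
    ∃ t : Finset Ω,
      (t : Set Ω) ⊆ Subfield.closure (Set.range (algebraMap S Ω) ∪ (s₀ : Set Ω)) ∧
      (s₀ : Set Ω) ⊆ Subfield.closure (Set.range (algebraMap S Ω) ∪ (t : Set Ω)) ∧
      ∃ hTO : (Algebra.adjoin S (t : Set Ω)).toSubring ≤ OΩ.toSubring,
        IsRegularLocalRing (Localization.AtPrime
          (Ideal.comap (Subring.inclusion hTO) (maximalIdeal OΩ))) := by
  classical
  haveI : IsDomain S := isDomain_of_isRegularLocalRing S
  have hSF : ∀ s : S, algebraMap S Ω s ∈ Subfield.closure (Set.range (algebraMap S Ω)) :=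
    fun s => Subfield.subset_closure ⟨s, rfl⟩
  -- the base: `S[∅]`
  have hTO₀ : (Algebra.adjoin S (((∅ : Finset Ω) : Finset Ω) : Set Ω)).toSubring ≤ OΩ.toSubring := by
    intro w hw
    rw [Finset.coe_empty, Algebra.adjoin_empty] at hw
    obtain ⟨s, rfl⟩ := Algebra.mem_bot.mp (show w ∈ (⊥ : Subalgebra S Ω) from hw)
    exact hSO s
  have hINV₀ : ∃ t : Finset Ω, (t : Set Ω) ⊆ Subfield.closure (Set.range (algebraMap S Ω)) ∧
      Subfield.closure (Set.range (algebraMap S Ω)) ≤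
        Subfield.closure (Set.range (algebraMap S Ω) ∪ (t : Set Ω)) ∧
      ∃ hTO : (Algebra.adjoin S (t : Set Ω)).toSubring ≤ OΩ.toSubring,
        IsRegularLocalRing (Localization.AtPrime
          (Ideal.comap (Subring.inclusion hTO) (maximalIdeal OΩ))) :=
    ⟨∅, by simp, by rw [Finset.coe_empty, Set.union_empty], hTO₀,
      isRegularLocalRing_centre_adjoin_empty hinj OΩ hSO hdom hTO₀⟩
  obtain ⟨t, htK, hKcl, hTO, hreg⟩ :=
    CossartPiltant2019Local.exists_model_of_isNormalPTower OΩ hloc p hinj hS hSdim hSchar hSO hdom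
      hres htower hSF hchar hINV₀
  exact ⟨t, htK, fun w hw => hKcl (Subfield.subset_closure (Set.mem_union_right _ hw)), hTO, hreg⟩

end Literature.AlgebraicGeometry.Resolution

end
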